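import Mathlib.Analysis.SpecialFunctions.Pow.Real
import Literature.Computability.AlgebraicComplexity.IMMDepthFour
import Literature.Computability.AlgebraicComplexity.TavenasHomogeneous
import Literature.Computability.AlgebraicComplexity.DepthReductionProofs
import HarnessLib
import HarnessLib.Audit

/-!
# Barrier catalogue `ValiantsHypothesis`: the chasm at depth four as a constraint — Tavenas'
depth reduction is tight for `VP` (Kumar–Saraf 2017, Cor. 1.3), so depth-4 lower-bound methods
must cross `n^{Θ(√d)}` exactly, and cannot while saturated by a `VP` family

D-0021 barrier entry for the summit `ValiantsHypothesis` (`VP_ℂ ≠ VNP_ℂ`), sub-approach "depth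
reduction + bounded-depth lower bounds" (route `ValiantsHypothesis/Depth4`, decls `Depth4Thesis`,
`Depth4Homogeneous`, `Depth4GeneralExp`, `Depth4Tavenas` of
`Summit.ValiantsHypothesis.ValiantsHypothesis.Theses.Depth4`).

**AUDIT (provefact, 2026-08-14): `DepthReductionChasm` is MIS-STATED relative to its source and
is not dischargeable.** It renders Kumar–Saraf's Cor. 1.3 over `homProductDepthCircuitSize 2`,
i.e. over homogeneous circuits of PRODUCT-DEPTH `≤ 2`, a class that admits a layer of sum gates
below the bottom products (products of linear forms: homogeneous `ΣΠΣΠΣ` = depth-5 circuits,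
`ArithCircuit.exists_productDepth_two_not_isDepthFour`), whereas the source's `ΣΠΣΠ` circuits
are "of depth 4 with … the second and the bottom layer hav[ing] only product gates"
[Kumar–Saraf 2017, §3], bottom products multiplying leaves. An `n^{Ω(√n)}` lower bound against
homogeneous depth-5 circuits in the chasm regime is an OPEN problem (finite fields:
`exp(Ω_q(√d))` only [Kumar–Saptharishi 2017, Thm. 1]; characteristic `0`: superpolynomial only
for `d ≤ log² n` [Amireddy–Garg–Kayal–Saha–Thankey 2023, Thm. 1.3, Open Problem 1.2]). So this
file's `DepthReductionChasm` and the tree fact `kumar_saraf_imm_depth4` it is derived from are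
STRONGER than print; they remain named `Prop`s (nothing is asserted) and every theorem below that
uses them is an implication from them, hence valid (the `PolyMeasure` theorems do not use
them). The printed statements live in
`Literature/Computability/AlgebraicComplexity/HomogeneousDepthFour.lean`
(`homDepthFourCircuitSize`, `kumarSaraf2017_imm_homDepthFour`) and in the sibling
`DepthReductionChasmDepthFour.lean` (`DepthReductionChasmDepthFour`, implied by
`DepthReductionChasm`; `IMM ∈ VP` is meanwhile PROVED, `isVPFamily_immPoly_holds`). Wherever this
file says "`ΣΠΣΠ`" for `productDepthCircuitSize 2` / `homProductDepthCircuitSize 2`, read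
"product-depth `2` (which includes `ΣΠΣΠΣ`)"; the UPPER-bound uses (Tavenas) are unaffected.

**VERDICT CLEAN-UP (defact, 2026-08-15).** Following the verdicts of the two fact seats, neither
`Prop` of technique class 1 below counts as literature debt any more; both statements are
unchanged byte-for-byte. `DepthReductionChasm` (verdict: mis-stated, see the audit above) is
`@[deprecated]` in favour of the corrected, printed statement `DepthReductionChasmDepthFour` of
the sibling file (which it implies, `DepthReductionChasm.depthFour`, ibid.); it survives solely as
the hypothesis / conclusion of the conditional theorems `depthReductionChasm_of_kumarSaraf`,
`DepthReductionChasm.not_improvedDepthReduction` (here, `linter.deprecated` switched off for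
exactly these two, which must name it) and `depthReductionChasm_of_kumarSaraf'`,
`DepthReductionChasm.depthFour`, `DepthReductionChasm.not_improvedDepthReductionDepthFour`
(sibling). `ImprovedDepthReduction` (verdict: open problem — a technique-class hypothesis, not a
published result, decided neither way in print) is registered as an OPEN statement
(`OPEN CONJECTURE — … [status: open]`): whether `VP` reduces to homogeneous depth-5 circuits more
cheaply than to homogeneous depth-4 circuits is posed in [Kumar–Saptharishi 2017, §3.4], and the
negation of the `Prop` would be an `n^{Ω(√n)}` (infinitely often) lower bound against homogeneous
depth-5 circuits over characteristic `0`, where exponential lower bounds are posed as open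
[Amireddy–Garg–Kayal–Saha–Thankey 2023, Open Problem 1.2]; it keeps its name (no `…Conjecture` rename) because the sibling's
`ImprovedDepthReductionDepthFour.improvedDepthReduction` and the two theorems here use it.

**The printed results** (checked with `lit read`).

* Tavenas, arXiv:1304.5777 = Inform. and Comput. 240 (2015), Thm. 1: "Let `f` be an `n`-variate
  polynomial computed by a circuit of size `s` and of degree `d`. Then `f` is computed by a
  `ΣΠ^{[O(α)]}ΣΠ^{[β]}` circuit `C` of size `2^{O(√(d log(ds) log n))}` where
  `α = √(d log n / log ds)` and `β = √(d log ds / log n)`. Furthermore, if `f` is homogeneous, it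
  will be also the case for `C`." For `VP` families (`s, d ≤ poly(n)`) this is `(n+2)^{O(√d)}`
  gates. Tree: `productDepthCircuitSize_two_le_of_isVPFamily` (named fact, DISCHARGED as
  `productDepthCircuitSize_two_le_of_isVPFamily_holds`, `DepthReductionProofs.lean`) and
  its homogeneous form `homProductDepthCircuitSize_two_le_of_isVPFamily` (named fact,
  `TavenasHomogeneous.lean`), both with the bound `(n + 2) ^ (c * ⌊√(deg fₙ)⌋ + c)`.
* Kumar–Saraf, arXiv:1404.1950 = SIAM J. Comput. 46 (2017), Thm. 1.2 (Main Theorem): "Let `𝔽` be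
  any field. There exists an explicit family of polynomials (over `𝔽`) of degree `n` and in
  `N = n^{O(1)}` variables in `VP`, such that any homogeneous `ΣΠΣΠ` circuit computing it has size
  at least `n^{Ω(√n)}`." Cor. 1.3 (Depth reduction is tight): "There exists a polynomial in `VP`
  of degree `n` in `N = n^{O(1)}` variables such that any homogeneous `ΣΠΣΠ` circuit computing it
  has size at least `n^{Ω(√n)}`. In other words, the upper bound in the depth reduction of
  Tavenas [Tav13] is tight, even when the bottom fan-in is unbounded." The polynomial is
  `IMM` (§1.1 after Cor. 1.3; §3: "`IMM_{a,b}` ... the `(1,1)` entry of `∏_j M_j` ... can be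
  computed by a polynomial sized circuit, and so is in `VP`"). Tree: `kumar_saraf_imm_depth4`
  (named fact, `IMMDepthFour.lean`, for the trace form `immPoly (n^c) n k`).
* Kumar–Saraf 2017, §1 (p. 2): "any asymptotic improvement in the exponent, in either the upper
  bound on depth reduction or the lower bound of [KSS13] would separate `VNP` from `VP`"; (p. 3):
  "can one improve upon the upper bounds obtained by Koiran and Tavenas? If we could do this over
  the reals/complex numbers, then given the [KLSS14] result, this would also suffice in separating
  `VP` from `VNP`!"; §10 (Open problems, p. 32): "since our lower bounds hold for a polynomial in `VP`, thus the
  bound on the size of the depth 4 circuit obtained in the depth reduction cannot be improved.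
  Although they cannot be improved for general circuits in `VP`, they might be possible to improve
  for other rich and interesting classes of circuits such as formulas or even homogeneous
  formulas." Kumar–Saraf, arXiv:1311.6716 = SIAM J. Comput. 44 (2015), §1: Main Theorem 2
  (informal) — Tavenas' procedure "cannot be improved even for homogeneous formulas" when reducing
  to homogeneous `ΣΠΣΠ^{[t]}` circuits, `ω(log n) ≤ t ≤ εn`.
* Gupta–Kamath–Kayal–Saptharishi, J. ACM 61 (2014), §7 "Limitations of the measure of shifted
  partials": "Theorem 1 shows that a lower bound of `exp(ω(√n log n))` on the size of any
  `ΣΠ^{[O(√n)]}ΣΠ^{[√n]}`-circuit computing `Perm_n` ... thus proving `VP ≠ VNP`. ... However,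
  with the current upper bound for a `ΣΠ^{[O(√n)]}ΣΠ^{[√n]}` circuit, the current technique
  cannot yield a bound of `exp(ω(√n log n))`", made quantitative in Prop. 21: with the estimate of
  Cor. 10 "the best lower bound we can obtain for a `N`-variate degree `d` polynomial computed by a
  `ΣΠ^{[O(√d)]}ΣΠ^{[√d]}` circuit is `exp(O(√d log N))`".

**What this file does** (everything over `ℂ`, the summit's field; sizes in the tree's
unbounded-fan-in product-depth model, `productDepthCircuitSize 2` = `ΣΠΣΠ` and
`homProductDepthCircuitSize 2` = homogeneous `ΣΠΣΠ`, gates counted).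

1. Technique class `ImprovedDepthReduction` — the "improve the reduction" half of the programme:
   every `VP` family of homogeneous degree-`n` polynomials has homogeneous `ΣΠΣΠ` circuits of size
   `n^{o(√n)}`. The barrier fact `DepthReductionChasm` is Cor. 1.3 in tree language (a `VP` family
   of homogeneous degree-`n` polynomials with homogeneous `ΣΠΣΠ` size `≥ n^{ε√n}` for large `n`);
   it is DERIVED (`depthReductionChasm_of_kumarSaraf`) from the tree fact `kumar_saraf_imm_depth4`,
   the PROVED homogeneity `immPoly_isHomogeneous_holds` (`StandardFamilies.lean`) and the
   named fact `IMM ∈ VP` (`isVPFamily_immPoly`, `IMMInVP.lean`, KS §3; taken as an explicit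
   hypothesis), and it REFUTES the class (`DepthReductionChasm.not_improvedDepthReduction`,
   proved: `n^{ε√n}` versus `n^{(ε/2)√n}`). AUDIT 2026-08-14 (see above): both the class and
   the `Prop` are stated over the product-depth-2 (depth-5-target) measure, so
   `DepthReductionChasm` is STRONGER than Cor. 1.3 and the refutation is conditional on it; the
   printed class `ImprovedDepthReductionDepthFour`, its refutation from the printed Cor. 1.3 and
   the implication `ImprovedDepthReductionDepthFour → ImprovedDepthReduction` are in the sibling
   `DepthReductionChasmDepthFour.lean` (`IMM ∈ VP` is meanwhile proved, `isVPFamily_immPoly_holds`).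
   Nothing printed excludes `ImprovedDepthReduction` itself (reduction INTO homogeneous depth-5
   circuits of size `n^{o(√n)}`).
2. Technique class of `VP`-saturated sound measures — Cor. 1.3 read contrapositively (KS §10;
   cf. GKKS §7 for the shifted-partials instance): a measure
   `μ` on polynomials that never exceeds (homogeneous) `ΣΠΣΠ` size (`PolyMeasure.IsDepthFourSound`,
   `PolyMeasure.IsHomDepthFourSound`; every "measure ≤ U(size)" argument is of this form after
   composing with `U⁻¹`) and whose value on `per_n` is dominated, up to a constant `C` in the exponent, by its value on
   some `VP` family of degree `≤ n` (`PolyMeasure.VPSaturated μ C n₁`, `PolyMeasure.HomVPSaturated`).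
   THEOREMS: such a `μ` itself obeys the chasm bound `μ(per_n) ≤ (n+2)^{c√n+c}` for some `c`
   (`PolyMeasure.chasm_bound_of_vpSaturated`, unconditional, from the discharged Tavenas fact;
   `PolyMeasure.hom_chasm_bound_of_vpSaturated`, from the homogeneous Tavenas fact), hence cannot
   witness the route's theses `Depth4Thesis` / `Depth4Homogeneous` (an `(n+2)^{c√n+c}` lower bound
   for EVERY `c`): `PolyMeasure.not_depth4_witness_of_vpSaturated`,
   `PolyMeasure.not_homDepth4_witness_of_vpSaturated`. By Cor. 1.3 the saturation ceiling is
   itself `n^{Ω(√n)}` (attained by `IMM ∈ VP`), i.e. the whole difficulty is the constant in the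
   exponent, as the route text records.

## References

* [Tavenas2015] S. Tavenas, Inform. and Comput. 240 (2015) 2–11 (MFCS 2013; arXiv:1304.5777),
  Thm. 1, Thm. 2, Cor. 1.
* [KumarSaraf2017] M. Kumar, S. Saraf, SIAM J. Comput. 46 (2017) 336–387 (FOCS 2014;
  arXiv:1404.1950), Thm. 1.1, Thm. 1.2, Cor. 1.3, Cor. 1.4, §1 pp. 2–3, §3, §10 (Open problems) p. 32.
* [KumarSaraf2015] M. Kumar, S. Saraf, SIAM J. Comput. 44 (2015) 1601–1625 (STOC 2014;
  arXiv:1311.6716), §1 (Thm. 1.1, Thm. 1.2, Main Theorems 1–2).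
* [FournierLimayeMalodSrinivasan2015] H. Fournier, N. Limaye, G. Malod, S. Srinivasan, SIAM J.
  Comput. 44 (2015) 1173–1201, Thm. 1 (bounded bottom fan-in; cited after KS 2017 §1).
* [GuptaKamathKayalSaptharishi2014] A. Gupta, P. Kamath, N. Kayal, R. Saptharishi, J. ACM 61
  (2014) 33, Thm. 1–2, §7 (Prop. 21), §8 (Conj. 24).
* [AgrawalVinay2008] M. Agrawal, V. Vinay, FOCS 2008.
* [KumarSaptharishi2017] M. Kumar, R. Saptharishi, CCC 2017 (LIPIcs 79) 31, Thm. 1 (p. 31:4), §1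
  (audit), §3.4 "The tightness of the results and relevance to VP vs. VNP" (p. 31:9; arXiv
  v. §7.4) (verdict clean-up).
* [AmireddyGargKayalSahaThankey2023] P. Amireddy, A. Garg, N. Kayal, C. Saha, B. Thankey, ICALP
  2023 (LIPIcs 261) 12 (arXiv:2211.07691), Thm. 1.3, Rem. 1.4, Open Problems 1.1–1.2 (audit,
  verdict clean-up).
-/

noncomputable section

namespace Literature.Barriers.ValiantsHypothesis

open Literature.Computability.AlgebraicComplexity MvPolynomial

/-! ### Technique class 1: improving the exponent of the depth reduction -/

/-- OPEN CONJECTURE — registered open statement, not literature debt (verdict clean-up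
2026-08-15: a technique-class hypothesis, not a published result; print decides it neither way,
so no `_holds` and no refutation can be vendored). Posed, as a question, in
[cite: KumarSaptharishi2017, §3.4 (p. 31:9)]: "it is not clear if we can use computational
advantage of having linear forms at the bottom level of the circuit to get a better depth
reduction from VP to homogeneous depth-5 circuits, when compared to depth reduction to
homogeneous depth-4 circuits"; the negation of the `Prop` below — a `VP` family of degree-`n`
homogeneous polynomials over `ℂ` and an `ε > 0` with homogeneous depth-5 size `> ⌈n^{ε√n}⌉` for
infinitely many `n`, i.e. an `exp(Ω(√n log n))` lower bound at degree `d = n` against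
homogeneous depth-5 circuits over characteristic `0` — falls under
[cite: AmireddyGargKayalSahaThankey2023, Open Problem 1.2] ("Prove exponential lower bounds for
constant-depth arithmetic formulas. This is interesting even for homogeneous depth-5 formulas");
in print: `exp(Ω_q(√d))` over each fixed `𝔽_q`, for a `VNP` family
[cite: KumarSaptharishi2017, Thm. 1 (p. 31:4)], and over characteristic `0` only
`n^{Ω(√d)}/2^{O(d)}` for homogeneous product-depth-`2` formulas, superpolynomial for
`d ≤ ε log² n` [cite: AmireddyGargKayalSahaThankey2023, Thm. 1.3 and Rem. 1.4]. [status: open]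

**Technique class: an improved depth reduction to homogeneous product-depth-`2` (`ΣΠΣΠΣ`,
depth-5) circuits over `ℂ`.** For every `VP` family `f = (fₙ)` over `ℂ` of homogeneous
polynomials of degree `n` (so `poly(n)` variables and fan-in-two size, `IsVPFamily`) and every
`ε > 0`, `homProductDepthCircuitSize 2 (f n) ≤ ⌈n^{ε√n}⌉` for all large `n`. Here
`homProductDepthCircuitSize 2` minimises over homogeneous circuits of product-depth `≤ 2`
(`ArithCircuit.productDepth` weighs sum gates `0`), which may carry a layer of sum gates below
the bottom products, i.e. over homogeneous `ΣΠΣΠΣ` circuits (module docstring, AUDIT). This is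
the depth-5-TARGET weakening of the printed question "If one relaxes away the requirement of
bounded bottom fanin, i.e. all one requires is to reduce to the class of general depth 4
homogeneous circuits, can one improve upon the upper bounds obtained by Koiran and Tavenas? If we
could do this over the reals/complex numbers, then given the [KLSS14] result, this would also
suffice in separating `VP` from `VNP`!" [cite: KumarSaraf2017, §1 (p. 3)], answered in the
negative for the depth-4 target by their Cor. 1.3: that printed class is
`ImprovedDepthReductionDepthFour` of the sibling `DepthReductionChasmDepthFour.lean`, which
implies this one (`ImprovedDepthReductionDepthFour.improvedDepthReduction`) and is refuted there
(`not_improvedDepthReductionDepthFour`). The present class is refuted in this file only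
CONDITIONALLY, from the deprecated, stronger-than-print `DepthReductionChasm`
(`DepthReductionChasm.not_improvedDepthReduction`, `not_improvedDepthReduction`); nothing
printed excludes it. [cite: KumarSaraf2017, §1 (pp. 2–3) and Cor. 1.3] -/
@[conjecture] def ImprovedDepthReduction : Prop :=
  ∀ {σ : ℕ → Type} [∀ n, Fintype (σ n)] (f : ∀ n, MvPolynomial (σ n) ℂ),
    IsVPFamily f → (∀ n, (f n).IsHomogeneous n) →
      ∀ ε : ℝ, 0 < ε → ∃ n₀ : ℕ, ∀ n : ℕ, n₀ ≤ n →
        homProductDepthCircuitSize 2 (f n) ≤ ((⌈(n : ℝ) ^ (ε * Real.sqrt n)⌉₊ : ℕ) : ℕ∞)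

/-! ### The barrier fact: depth reduction is tight (Kumar–Saraf 2017, Cor. 1.3) -/

/-- **DEPRECATED (verdict clean-up 2026-08-15): a MIS-STATED rendering of Kumar–Saraf 2017,
Cor. 1.3 — use the corrected, printed statement `DepthReductionChasmDepthFour`
(`Literature/Barriers/ValiantsHypothesis/DepthReductionChasmDepthFour.lean`, p16733), which this
`Prop` implies (`DepthReductionChasm.depthFour`, ibid.), not conversely.** What is wrong: the
measure `homProductDepthCircuitSize 2` minimises over homogeneous circuits of PRODUCT-depth `≤ 2`
(`ArithCircuit.productDepth` weighs sum gates `0`), a class admitting a layer of sum gates below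
the bottom products, i.e. homogeneous `ΣΠΣΠΣ` = depth-5 circuits
(`ArithCircuit.exists_productDepth_two_not_isDepthFour`), whereas the source's `ΣΠΣΠ` circuit
is "a circuit of depth 4 with the top layer and the third layer only have sum gates and the
second and the bottom layer have only product gates" [cite: KumarSaraf2017, §3]. An
`n^{Ω(√n)}` lower bound at degree `d = n` against homogeneous depth-5 circuits over `ℂ` is not
in print: over each fixed `𝔽_q` one has `exp(Ω_q(√d))`, for a `VNP` family
[cite: KumarSaptharishi2017, Thm. 1 (p. 31:4)]; over characteristic `0` one has
`n^{Ω(√d)}/2^{O(d)}` for homogeneous product-depth-`2` formulas, superpolynomial for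
`d ≤ ε log² n`, and exponential bounds are posed as open "even for homogeneous depth-5 formulas"
[cite: AmireddyGargKayalSahaThankey2023, Thm. 1.3, Rem. 1.4 and Open Problem 1.2]. Hence the
statement below is STRONGER than print and not dischargeable from the literature (verdict of
the provefact seat, re-verified 2026-08-15). It is kept byte-for-byte — a `Prop`, nothing is
asserted — solely as the conclusion / hypothesis of the conditional theorems
`depthReductionChasm_of_kumarSaraf` and `DepthReductionChasm.not_improvedDepthReduction` below
and of the sibling's `depthReductionChasm_of_kumarSaraf'`, `DepthReductionChasm.depthFour`,
`DepthReductionChasm.not_improvedDepthReductionDepthFour`; no consumer should take it as a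
hypothesis in place of `DepthReductionChasmDepthFour`. The original entry follows unchanged; its
BARRIER block is retained for the record (route headers cite this name, and the sibling's block
refers to it) — the live catalogue entry for this barrier is `DepthReductionChasmDepthFour`.

**Original entry. Depth reduction is tight (Kumar–Saraf 2017, Cor. 1.3;
Fournier–Limaye–Malod–Srinivasan 2015 for bounded bottom fan-in), over `ℂ`, in tree language:
"There exists a polynomial in `VP` of degree `n` in `N = n^{O(1)}` variables such that any
homogeneous `ΣΠΣΠ` circuit computing it has size at least `n^{Ω(√n)}`. In other words, the upper
bound in the depth reduction of Tavenas is tight, even when the bottom fan-in is unbounded."**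
Rendered: there is a `VP` family `f` over `ℂ`
of homogeneous degree-`n` polynomials and `ε > 0`, `n₀` with
`⌈n^{ε√n}⌉ ≤ homProductDepthCircuitSize 2 (f n)` for all `n ≥ n₀`. Derived below from the tree's
`IMM` fact (`depthReductionChasm_of_kumarSaraf`); consequences: `not_improvedDepthReduction`.
AUDIT (2026-08-14): this rendering is STRONGER than print — `homProductDepthCircuitSize 2`
ranges over homogeneous product-depth-2 = depth-5 (`ΣΠΣΠΣ`) circuits, for which `n^{Ω(√n)}`
is an open problem (module docstring); the printed depth-4 statement is the sibling
`DepthReductionChasmDepthFour` (`DepthReductionChasmDepthFour.lean`), which this `Prop` implies.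

BARRIER
technique_class: depth-reduction, chasm-at-depth-four, improved-depth-reduction, homogeneous-depth-four-lower-bounds, VP-saturated-complexity-measures, shifted-partial-derivatives, projected-shifted-partials
blocks: (i) the "improve the reduction" way to `ValiantsHypothesis` — `ImprovedDepthReduction` (homogeneous `ΣΠΣΠ` size `n^{o(√n)}` for every homogeneous degree-`n` `VP` family over `ℂ`), which together with the known `n^{Ω(√n)}` homogeneous-`ΣΠΣΠ` bounds for explicit `VNP` families would separate `VP` from `VNP` [cite: KumarSaraf2017, §1 (p. 3)]; refuted only CONDITIONALLY on the stronger-than-print `DepthReductionChasm` (`DepthReductionChasm.not_improvedDepthReduction`) — the printed block is `ImprovedDepthReductionDepthFour` of the sibling `DepthReductionChasmDepthFour.lean` (reduction into depth-4 circuits, refuted by the printed Cor. 1.3), while the product-depth-2-target class `ImprovedDepthReduction` itself (reduction into homogeneous depth-5 circuits) is not excluded by anything printed [cite: AmireddyGargKayalSahaThankey2023, Open Problem 1.2]; (ii) on the lower-bound side (route `ValiantsHypothesis/Depth4`: `Depth4Thesis`, `Depth4Homogeneous`, i.e. `(n+2)^{c√n+c} <` (homogeneous) `ΣΠΣΠ`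 size of `per_n` for EVERY `c`, sufficient by [cite: Tavenas2015, Thm. 1–2]), every complexity-measure argument whose measure `μ` is sound for (homogeneous) `ΣΠΣΠ` size and `VP`-saturated at the permanent with some slack exponent `C` — `μ(per_n) ≤ μ(g_n)^C` for a `VP` family `g` of degree `≤ n` (`PolyMeasure.VPSaturated`, `PolyMeasure.HomVPSaturated`) — obeys the chasm bound `μ(per_n) ≤ (n+2)^{c'√n+c'}` itself and cannot witness these theses (`PolyMeasure.chasm_bound_of_vpSaturated`, `PolyMeasure.not_depth4_witness_of_vpSaturated`, `PolyMeasure.hom_chasm_bound_of_vpSaturated`, `PolyMeasure.not_homDepth4_witness_of_vpSaturated`) [cite: KumarSaraf2017, Cor. 1.3 and §10 (Open problems, p. 32)]; intended members are the (projected) shifted-partials measures normalised by their per-gate estimates: `IMM_{n^{O(1)},n} ∈ VP` attains `n^{Ω(√n)}` under the projected measure [cite: KumarSaraf2017, Thm. 1.2], while the printed counting ceiling — for PLAIN shifted partials against `ΣΠ^{[O(√d)]}ΣΠ^{[√d]}` (bounded bottom fan-in) — caps the measure at `2^{O(√d log N)} = n^{O(√n)}` on every `N`-variate degree-`d` polynomial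 [cite: GuptaKamathKayalSaptharishi2014, §7 (Prop. 21)]; membership with `C = O(1)` follows wherever the analogous ceiling holds for the sound (unbounded fan-in) normalisation, which is not printed (see `scope_caveats`).
because: Tavenas' reduction computes every `n^{O(1)}`-variate degree-`d` polynomial with `poly(n)`-size circuits by homogeneous `ΣΠ^{[O(√d)]}ΣΠ^{[√d]}` circuits of size `2^{O(√(d log(ds) log n))} = n^{O(√d)}` [cite: Tavenas2015, Thm. 1] (tree: `productDepthCircuitSize_two_le_of_isVPFamily_holds`, proved; homogeneous form `homProductDepthCircuitSize_two_le_of_isVPFamily`), so a sound measure is `≤ (n+2)^{c√d+c}` on every `VP` family and therefore `≤ (n+2)^{Cc√n+Cc}` on every polynomial it does not separate from one with slack `C` — "since our lower bounds hold for a polynomial in `VP`, thus the bound on the size of the depth 4 circuit obtained in the depth reduction cannot be improved" [cite: KumarSaraf2017, §10 (Open problems, p. 32)], and for the shifted-partials measure specifically "with the current upper bound for a `ΣΠ^{[O(√n)]}ΣΠ^{[√n]}` circuit, the current technique cannot yield a bound of `exp(ω(√n log n))`" [cite: GuptaKamathKayalSaptharishi2014, §7]; conversely `IMM_{n^{O(1)},n}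 ∈ VP` requires homogeneous `ΣΠΣΠ` size `n^{Ω(√n)}` over every field (random restrictions to bounded bottom support, then projected shifted partial derivatives bounded combinatorially) [cite: KumarSaraf2017, Thm. 1.2 and §2 (Proof Overview)], so the exponent of the reduction cannot be lowered even for unbounded bottom fan-in — the question "can one improve upon the upper bounds obtained by Koiran and Tavenas? If we could do this over the reals/complex numbers, then given the [KLSS14] result, this would also suffice in separating `VP` from `VNP`!" is answered in the negative [cite: KumarSaraf2017, §1 (p. 3) and Cor. 1.3].
evasions_known: none published that crosses `n^{ω(√d)}` for an explicit family — whether shifted-partials-type measures "have the potential of separating `VP` from `VNP`" is posed as open [cite: KumarSaraf2017, §10 (Open problems, p. 32)]; GKKS conjectured a non-saturated use of shifted partials, the dimension for `Perm_n` exceeding that for the SAME-SIZE `Det_n` superpolynomially [cite: GuptaKamathKayalSaptharishi2014, §8 (Conj. 24)], but for the comparison that bears on `VP ≠ VNP` (padded `ℓ^{n-m} per_m` versus `det_n`) the method of shifted partial derivatives provably cannot separate once `n > 2m² + 2m`, i.e. there the measure IS dominated by a `VP` polynomial [cite: EfremenkoLandsbergSchenckWeyman2018, Thm. 1.5] (catalogue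 entry `ShiftedPartialDerivatives`); improved depth reduction remains possible for subclasses — it holds for regular formulas (KSS 2013, as cited in [cite: KumarSaraf2015, §1]) and is not excluded for (homogeneous) formulas when reducing to general homogeneous `ΣΠΣΠ` [cite: KumarSaraf2017, §10 (Open problems, p. 32)], though excluded for homogeneous formulas when reducing to `ΣΠΣΠ^{[t]}`, `ω(log n) ≤ t ≤ εn` [cite: KumarSaraf2015, §1 (Main Theorem 2)].
scope_caveats: Cor. 1.3 is asymptotic and concerns HOMOGENEOUS `ΣΠΣΠ` (unbounded fan-in) over any field; nothing is printed about tightness of the reductions to inhomogeneous depth four or to depth three over `ℚ` (`ΣΠΣ` of size `2^{O(√(d log n log s))}` [cite: Tavenas2015, Cor. 1]), so `Depth4GeneralExp`-type inhomogeneous statements are not addressed; the Lean class `ImprovedDepthReduction` fixes the field `ℂ` and degree exactly `n` (print: degree `n`, `N = n^{O(1)}` variables, all fields) and the tree fact `kumar_saraf_imm_depth4` is the trace rendering of the `(1,1)`-entry statement (see `IMMDepthFour.lean`); the measure theorems are the abstract (contrapositive) form of Cor. 1.3 / KS §10 — print quantifies a measure's ceiling only for the shifted-partials measure with the Cor. 10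 estimate against `ΣΠ^{[O(√d)]}ΣΠ^{[√d]}` [cite: GuptaKamathKayalSaptharishi2014, §7 (Prop. 21)] — and say nothing about measures that are not `VP`-saturated at the permanent for any slack `C`; `DepthReductionChasm` is derived from two named facts (`kumar_saraf_imm_depth4`, `isVPFamily_immPoly`) and the proved `immPoly_isHomogeneous_holds`, not discharged from first principles (AUDIT 2026-08-14: `isVPFamily_immPoly` is now proved, `isVPFamily_immPoly_holds`; but the measure `homProductDepthCircuitSize 2` makes THIS rendering a statement about homogeneous depth-5 circuits, stronger than the printed Cor. 1.3 and open in that generality [cite: KumarSaptharishi2017, Thm. 1] [cite: AmireddyGargKayalSahaThankey2023, Open Problem 1.2]; the printed depth-4 statement is `DepthReductionChasmDepthFour` of the sibling file, implied by this one).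
status: established AS PRINTED, i.e. for homogeneous depth-4 circuits [cite: KumarSaraf2017, Cor. 1.3] (sibling `DepthReductionChasmDepthFour`); the present product-depth-2 rendering is stronger than print and not known [cite: AmireddyGargKayalSahaThankey2023, Open Problem 1.2]; DEPRECATED 2026-08-15 in favour of `DepthReductionChasmDepthFour` (see the head of this docstring) -/
@[deprecated "`DepthReductionChasm` is mis-stated: `homProductDepthCircuitSize 2` ranges over \
  homogeneous depth-5 (product-depth-2) circuits, for which Kumar–Saraf 2017, Cor. 1.3 is not \
  in print and the bound is open; use the printed depth-4 statement \
  `Literature.Barriers.ValiantsHypothesis.DepthReductionChasmDepthFour` \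
  (Literature/Barriers/ValiantsHypothesis/DepthReductionChasmDepthFour.lean)" (since := "2026-08-15")]
def DepthReductionChasm : Prop :=
  ∃ (σ : ℕ → Type) (_ : ∀ n, Fintype (σ n)) (f : ∀ n, MvPolynomial (σ n) ℂ),
    IsVPFamily f ∧ (∀ n, (f n).IsHomogeneous n) ∧ ∃ (n₀ : ℕ) (ε : ℝ), 0 < ε ∧
      ∀ n : ℕ, n₀ ≤ n →
        ((⌈(n : ℝ) ^ (ε * Real.sqrt n)⌉₊ : ℕ) : ℕ∞) ≤ homProductDepthCircuitSize 2 (f n)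

-- `linter.deprecated` off for the next declaration only (verdict clean-up 2026-08-15): it
-- DERIVES the deprecated rendering `DepthReductionChasm` and must name it.
set_option linter.deprecated false in
/-- **Cor. 1.3 from Thm. 1.2** (conclusion: the DEPRECATED, stronger-than-print rendering
`DepthReductionChasm`; the printed form is `depthReductionChasmDepthFour_of_kumarSaraf` of the
sibling file): the tree's `IMM` fact `kumar_saraf_imm_depth4` (at the
field `ℂ`), homogeneity of `IMM_{m,d}` in degree `d` (PROVED in the tree:
`immPoly_isHomogeneous_holds`) and `IMM ∈ VP` over `ℂ` (hypothesis `hVP`, supplied by the tree's named fact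
`isVPFamily_immPoly` of `IMMInVP.lean` as `h ℂ`; kept as an explicit hypothesis so that
this file does not depend on that module) give `DepthReductionChasm` with the witness
`n ↦ IMM_{n^c, n}`. [cite: KumarSaraf2017, Thm. 1.2 and Cor. 1.3] -/
theorem depthReductionChasm_of_kumarSaraf (hKS : kumar_saraf_imm_depth4)
    (hVP : ∀ c : ℕ, IsVPFamily (fun n => immPoly (n ^ c) n ℂ)) :
    DepthReductionChasm := by
  obtain ⟨c, n₀, ε, hε, hlow⟩ := hKS ℂ
  exact ⟨fun n => Fin n × Fin (n ^ c) × Fin (n ^ c), inferInstance, fun n => immPoly (n ^ c) n ℂ,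
    hVP c, fun n => immPoly_isHomogeneous_holds (k := ℂ) (n ^ c) n, n₀, ε, hε, hlow⟩

/-- Real-analysis core of the refutation: if `2 ≤ x` then `⌈x⌉₊ < ⌈x * x⌉₊`. [folklore] -/
theorem ceil_lt_ceil_mul_self {x : ℝ} (hx : 2 ≤ x) : ⌈x⌉₊ < ⌈x * x⌉₊ := by
  refine Nat.lt_ceil.2 ?_
  have h1 : (⌈x⌉₊ : ℝ) < x + 1 := Nat.ceil_lt_add_one (by linarith)
  have h2 : x + 1 ≤ x * x := by nlinarith
  exact h1.trans_le h2

/-- For `0 < ε`, `4 ≤ n` and `(2/ε)² ≤ n` one has `2 ≤ n^{(ε/2)√n}` and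
`n^{ε√n} = n^{(ε/2)√n} · n^{(ε/2)√n}`. [folklore] -/
theorem two_le_rpow_half {ε : ℝ} (hε : 0 < ε) {n : ℕ} (h4 : 4 ≤ n)
    (hn : (2 / ε) ^ 2 ≤ (n : ℝ)) :
    2 ≤ (n : ℝ) ^ (ε / 2 * Real.sqrt n) ∧
      (n : ℝ) ^ (ε * Real.sqrt n) = (n : ℝ) ^ (ε / 2 * Real.sqrt n) * (n : ℝ) ^ (ε / 2 * Real.sqrt n) := by
  have hn4 : (4 : ℝ) ≤ n := by exact_mod_cast h4
  have hn1 : (1 : ℝ) ≤ n := by linarith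
  have hnpos : (0 : ℝ) < n := by linarith
  have hsqrt : 2 / ε ≤ Real.sqrt n := by
    have := Real.sqrt_le_sqrt hn
    rwa [Real.sqrt_sq (by positivity)] at this
  have hexp : (1 : ℝ) ≤ ε / 2 * Real.sqrt n := by
    have hε2 : (0 : ℝ) ≤ ε / 2 := by positivity
    calc (1 : ℝ) = ε / 2 * (2 / ε) := by field_simp
      _ ≤ ε / 2 * Real.sqrt n := mul_le_mul_of_nonneg_left hsqrt hε2
  refine ⟨?_, ?_⟩
  · calc (2 : ℝ) ≤ n := by linarith
      _ = (n : ℝ) ^ (1 : ℝ) := (Real.rpow_one _).symm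
      _ ≤ (n : ℝ) ^ (ε / 2 * Real.sqrt n) := Real.rpow_le_rpow_of_exponent_le hn1 hexp
  · rw [← Real.rpow_add hnpos]
    congr 1
    ring

-- `linter.deprecated` off for the next declaration only (verdict clean-up 2026-08-15): its
-- hypothesis IS the deprecated rendering `DepthReductionChasm`.
set_option linter.deprecated false in
/-- **The chasm refutes improved depth reduction** (Kumar–Saraf 2017, Cor. 1.3: "the upper bound
in the depth reduction of Tavenas is tight, even when the bottom fan-in is unbounded"): a `VP`
family needing homogeneous product-depth-`2` size `⌈n^{ε√n}⌉` cannot have such circuits of size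
`⌈n^{(ε/2)√n}⌉`. CONDITIONAL on the deprecated, stronger-than-print `DepthReductionChasm`
(verdict clean-up 2026-08-15); the printed, unconditional-modulo-Thm-1.2 form is
`DepthReductionChasmDepthFour.not_improvedDepthReductionDepthFour` of the sibling file, and the
refuted class `ImprovedDepthReduction` itself is registered OPEN. [cite: KumarSaraf2017, Cor. 1.3] -/
theorem DepthReductionChasm.not_improvedDepthReduction (h : DepthReductionChasm) :
    ¬ ImprovedDepthReduction := by
  intro hI
  obtain ⟨σ, _, f, hf, hhom, n₀, ε, hε, hlow⟩ := h
  obtain ⟨n₁, hup⟩ := hI f hf hhom (ε / 2) (half_pos hε)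
  set n : ℕ := max (max n₀ n₁) (max 4 ⌈(2 / ε) ^ 2⌉₊) with hn
  have hn₀ : n₀ ≤ n := le_max_of_le_left (le_max_left _ _)
  have hn₁ : n₁ ≤ n := le_max_of_le_left (le_max_right _ _)
  have h4 : 4 ≤ n := le_max_of_le_right (le_max_left _ _)
  have hceil : ⌈(2 / ε) ^ 2⌉₊ ≤ n := le_max_of_le_right (le_max_right _ _)
  have hreal : (2 / ε) ^ 2 ≤ (n : ℝ) := Nat.ceil_le.1 hceil
  have h12 : ((⌈(n : ℝ) ^ (ε * Real.sqrt n)⌉₊ : ℕ) : ℕ∞) ≤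
      ((⌈(n : ℝ) ^ (ε / 2 * Real.sqrt n)⌉₊ : ℕ) : ℕ∞) := (hlow n hn₀).trans (hup n hn₁)
  have h12' : ⌈(n : ℝ) ^ (ε * Real.sqrt n)⌉₊ ≤ ⌈(n : ℝ) ^ (ε / 2 * Real.sqrt n)⌉₊ := by
    exact_mod_cast h12
  obtain ⟨htwo, hsq⟩ := two_le_rpow_half hε h4 hreal
  rw [hsq] at h12'
  have hlt := ceil_lt_ceil_mul_self htwo
  omega

/-- The same conditional refutation directly from the tree facts (the stronger-than-print
`kumar_saraf_imm_depth4` and `IMM ∈ VP`). [cite: KumarSaraf2017, Cor. 1.3] -/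
theorem not_improvedDepthReduction (hKS : kumar_saraf_imm_depth4)
    (hVP : ∀ c : ℕ, IsVPFamily (fun n => immPoly (n ^ c) n ℂ)) :
    ¬ ImprovedDepthReduction :=
  (depthReductionChasm_of_kumarSaraf hKS hVP).not_improvedDepthReduction

/-! ### Technique class 2: sound complexity measures saturated by a `VP` family -/

/-- A **complexity measure** on polynomials over `ℂ` (any variable type in `Type`), valued in `ℕ∞`
— the shape of every "measure" lower-bound argument (dimension of partial derivatives, of
shifted partials `dim⟨∂^{=k} f⟩_{≤ℓ}`, of projected shifted partials, evaluation dimension, ...),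
normalised so that its value is directly a lower bound for circuit size (compose the raw measure
with the inverse of its per-size upper bound, GKKS Cor. 10 / Prop. 21).
[cite: GuptaKamathKayalSaptharishi2014, §7] -/
abbrev PolyMeasure : Type 1 :=
  ∀ ⦃σ : Type⦄, MvPolynomial σ ℂ → ℕ∞

namespace PolyMeasure

/-- `μ` is **sound for `ΣΠΣΠ` size**: it never exceeds the product-depth-`2` circuit size
(tree `productDepthCircuitSize 2`, unbounded fan-in, gates counted).
[cite: GuptaKamathKayalSaptharishi2014, §7] -/
def IsDepthFourSound (μ : PolyMeasure) : Prop :=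
  ∀ ⦃σ : Type⦄ [Fintype σ] (f : MvPolynomial σ ℂ), μ f ≤ productDepthCircuitSize 2 f

/-- `μ` is **sound for homogeneous `ΣΠΣΠ` size** (tree `homProductDepthCircuitSize 2`,
the model of Kumar–Saraf 2017 and of Tavenas' output). [cite: KumarSaraf2017, §1] -/
def IsHomDepthFourSound (μ : PolyMeasure) : Prop :=
  ∀ ⦃σ : Type⦄ [Fintype σ] (f : MvPolynomial σ ℂ), μ f ≤ homProductDepthCircuitSize 2 f

/-- Soundness for general `ΣΠΣΠ` implies soundness for homogeneous `ΣΠΣΠ`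
(`productDepthCircuitSize ≤ homProductDepthCircuitSize`). [folklore] -/
theorem IsDepthFourSound.isHomDepthFourSound {μ : PolyMeasure} (h : μ.IsDepthFourSound) :
    μ.IsHomDepthFourSound :=
  fun _ _ f => (h f).trans (productDepthCircuitSize_le_homProductDepthCircuitSize 2 f)

/-- `μ` is **`VP`-saturated at the permanent, with slack exponent `C`, from `n₁` on**: some `VP`
family `g` over `ℂ` (`IsVPFamily`, any variable sets) of degree `deg gₙ ≤ n` dominates the
permanent under `μ` UP TO A CONSTANT IN THE EXPONENT: `μ(per_n) ≤ μ(g_n) ^ C` for all `n ≥ n₁`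
(`C = 1`: exact domination). This is the sense in which a sound measure "does not separate `per_n`
from `VP`". Motivating instance (hedged): the PROJECTED shifted-partials measure of Kumar–Saraf,
normalised by its per-gate estimate for homogeneous `ΣΠΣΠ` (after the random restriction to bounded
bottom support), is `≥ n^{ε√n}` on `IMM_{n^{O(1)},n} ∈ VP` (KS Thm. 1.2) while a counting ceiling of
the GKKS Prop. 21 type (printed there for PLAIN shifted partials against `ΣΠ^{[O(√d)]}ΣΠ^{[√d]}`,
i.e. bounded bottom fan-in — not literally the unbounded-fan-in soundness used here) caps such
measures at `2^{O(√d log N)} = n^{O(√n)}` on every `N`-variate degree-`d` polynomial; to the extent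
the analogous ceiling holds for the projected measure, it is saturated with `C = O(1/ε)`.
[cite: KumarSaraf2017, §1 (p. 3) and Cor. 1.3] -/
def VPSaturated (μ : PolyMeasure) (C n₁ : ℕ) : Prop :=
  ∃ (σ : ℕ → Type) (_ : ∀ n, Fintype (σ n)) (g : ∀ n, MvPolynomial (σ n) ℂ),
    IsVPFamily g ∧ (∀ n, (g n).totalDegree ≤ n) ∧
      ∀ n : ℕ, n₁ ≤ n → μ (perPoly (Fin n) ℂ) ≤ μ (g n) ^ C

/-- Homogeneous variant of `VPSaturated` (slack exponent `C`): the dominating `VP` family consists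
of homogeneous polynomials (as `IMM`, `det`), the hypothesis of the homogeneous Tavenas fact.
[cite: KumarSaraf2017, §1 (p. 3) and Cor. 1.3] -/
def HomVPSaturated (μ : PolyMeasure) (C n₁ : ℕ) : Prop :=
  ∃ (σ : ℕ → Type) (_ : ∀ n, Fintype (σ n)) (g : ∀ n, MvPolynomial (σ n) ℂ),
    IsVPFamily g ∧ (∀ n, (g n).IsHomogeneous (g n).totalDegree) ∧ (∀ n, (g n).totalDegree ≤ n) ∧
      ∀ n : ℕ, n₁ ≤ n → μ (perPoly (Fin n) ℂ) ≤ μ (g n) ^ C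

/-- Monotonicity of the chasm bound in the degree: `(n+2)^{c⌊√d⌋+c} ≤ (n+2)^{c⌊√n⌋+c}` for
`d ≤ n`. [folklore] -/
theorem chasmBound_mono {d n : ℕ} (h : d ≤ n) (c m : ℕ) :
    ((m + 2 : ℕ∞) ^ (c * Nat.sqrt d + c)) ≤ ((m + 2 : ℕ∞) ^ (c * Nat.sqrt n + c)) :=
  pow_le_pow_right₀ (le_add_left (by norm_num))
    (Nat.add_le_add_right (Nat.mul_le_mul_left c (Nat.sqrt_le_sqrt h)) c)

/-- The slack exponent is absorbed into the chasm constant: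
`((m+2)^{c⌊√n⌋+c})^C = (m+2)^{(Cc)⌊√n⌋ + Cc}`. [folklore] -/
theorem chasmBound_pow (c C m n : ℕ) :
    (((m + 2 : ℕ∞) ^ (c * Nat.sqrt n + c)) ^ C) = ((m + 2 : ℕ∞) ^ (C * c * Nat.sqrt n + C * c)) := by
  rw [← pow_mul]
  congr 1
  ring

/-- **The chasm constrains `VP`-saturated measures (general `ΣΠΣΠ`; unconditional).** A measure
sound for `ΣΠΣΠ` size and `VP`-saturated at the permanent (slack `C`) from `n₁` on satisfies
Tavenas' bound on the permanent: `μ(per_n) ≤ (n+2)^{c'⌊√n⌋+c'}` for some `c'` (`= C·c`) and all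
`n ≥ n₁` — by the DISCHARGED depth reduction
`productDepthCircuitSize_two_le_of_isVPFamily_holds` applied to the dominating `VP` family
(the mechanism of KS Cor. 1.3 read contrapositively; cf. GKKS §7).
[cite: KumarSaraf2017, §1 (p. 3) and Cor. 1.3] -/
theorem chasm_bound_of_vpSaturated {μ : PolyMeasure} (hμ : μ.IsDepthFourSound) {C n₁ : ℕ}
    (hsat : μ.VPSaturated C n₁) :
    ∃ c : ℕ, ∀ n : ℕ, n₁ ≤ n → μ (perPoly (Fin n) ℂ) ≤ ((n + 2 : ℕ∞) ^ (c * Nat.sqrt n + c)) := by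
  obtain ⟨σ, _, g, hg, hdeg, hle⟩ := hsat
  obtain ⟨c, hc⟩ := productDepthCircuitSize_two_le_of_isVPFamily_holds g hg
  refine ⟨C * c, fun n hn => (hle n hn).trans ?_⟩
  rw [← chasmBound_pow]
  exact pow_le_pow_left' ((hμ (g n)).trans <| (hc n).trans <| chasmBound_mono (hdeg n) c n) C

/-- **Hence no witness for `Depth4Thesis` from a `VP`-saturated measure**: it is impossible that
for every `c` some `n ≥ n₁` has `(n+2)^{c⌊√n⌋+c} < μ(per_n)` (the shape of the route's thesis
`Depth4Thesis`, `∀ c, ∃ n, (n+2)^{c⌊√n⌋+c} < productDepthCircuitSize 2 per_n`, as certified by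
`μ`). [cite: KumarSaraf2017, §1 (p. 3) and Cor. 1.3] -/
theorem not_depth4_witness_of_vpSaturated {μ : PolyMeasure} (hμ : μ.IsDepthFourSound) {C n₁ : ℕ}
    (hsat : μ.VPSaturated C n₁) :
    ¬ ∀ c : ℕ, ∃ n : ℕ, n₁ ≤ n ∧ ((n + 2 : ℕ∞) ^ (c * Nat.sqrt n + c)) < μ (perPoly (Fin n) ℂ) := by
  obtain ⟨c, hc⟩ := chasm_bound_of_vpSaturated hμ hsat
  intro h
  obtain ⟨n, hn, hlt⟩ := h c
  exact (not_lt.mpr (hc n hn)) hlt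

/-- The case `n₁ = 0` verbatim in the shape of `Depth4Thesis` with `μ` in place of
`productDepthCircuitSize 2`. [cite: KumarSaraf2017, §1 (p. 3) and Cor. 1.3] -/
theorem not_depth4Thesis_shape_of_vpSaturated {μ : PolyMeasure} (hμ : μ.IsDepthFourSound)
    {C : ℕ} (hsat : μ.VPSaturated C 0) :
    ¬ ∀ c : ℕ, ∃ n : ℕ, ((n + 2 : ℕ∞) ^ (c * Nat.sqrt n + c)) < μ (perPoly (Fin n) ℂ) := by
  intro h
  refine not_depth4_witness_of_vpSaturated hμ hsat fun c => ?_
  obtain ⟨n, hn⟩ := h c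
  exact ⟨n, Nat.zero_le _, hn⟩

/-- **The chasm constrains `VP`-saturated measures (homogeneous `ΣΠΣΠ`)**, conditional on the
homogeneous Tavenas fact `homProductDepthCircuitSize_two_le_of_isVPFamily`: a measure
sound for homogeneous `ΣΠΣΠ` size and dominated on `per_n` by a homogeneous `VP` family of degree
`≤ n` up to the slack exponent `C` satisfies `μ(per_n) ≤ (n+2)^{c⌊√n⌋+c}` for some `c`, all
`n ≥ n₁`. [cite: KumarSaraf2017, §1 (p. 3) and Cor. 1.3] -/
theorem hom_chasm_bound_of_vpSaturated (hT : homProductDepthCircuitSize_two_le_of_isVPFamily)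
    {μ : PolyMeasure} (hμ : μ.IsHomDepthFourSound) {C n₁ : ℕ} (hsat : μ.HomVPSaturated C n₁) :
    ∃ c : ℕ, ∀ n : ℕ, n₁ ≤ n → μ (perPoly (Fin n) ℂ) ≤ ((n + 2 : ℕ∞) ^ (c * Nat.sqrt n + c)) := by
  obtain ⟨σ, _, g, hg, hhom, hdeg, hle⟩ := hsat
  obtain ⟨c, hc⟩ := hT g hg hhom
  refine ⟨C * c, fun n hn => (hle n hn).trans ?_⟩
  rw [← chasmBound_pow]
  exact pow_le_pow_left' ((hμ (g n)).trans <| (hc n).trans <| chasmBound_mono (hdeg n) c n) C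

/-- **Hence no witness for `Depth4Homogeneous` from a `VP`-saturated measure** (the route's
homogeneous crux `∀ c, ∃ n, (n+2)^{c⌊√n⌋+c} < homProductDepthCircuitSize 2 per_n`, as certified
by `μ`), conditional on the homogeneous Tavenas fact. [cite: KumarSaraf2017, §1 (p. 3) and Cor. 1.3] -/
theorem not_homDepth4_witness_of_vpSaturated
    (hT : homProductDepthCircuitSize_two_le_of_isVPFamily) {μ : PolyMeasure}
    (hμ : μ.IsHomDepthFourSound) {C n₁ : ℕ} (hsat : μ.HomVPSaturated C n₁) :
    ¬ ∀ c : ℕ, ∃ n : ℕ, n₁ ≤ n ∧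
      ((n + 2 : ℕ∞) ^ (c * Nat.sqrt n + c)) < μ (perPoly (Fin n) ℂ) := by
  obtain ⟨c, hc⟩ := hom_chasm_bound_of_vpSaturated hT hμ hsat
  intro h
  obtain ⟨n, hn, hlt⟩ := h c
  exact (not_lt.mpr (hc n hn)) hlt

/-- Non-vacuity of the technique class: the size measure `productDepthCircuitSize 2` itself is a
sound measure (so the theorems above are statements about saturation, not about soundness).
[folklore] -/
theorem isDepthFourSound_size : IsDepthFourSound (fun _ f => productDepthCircuitSize 2 f) :=
  fun _ _ _ => le_rfl

end PolyMeasure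

end Literature.Barriers.ValiantsHypothesis
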